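import Literature.MathematicalPhysics.KineticTheory.DiPernaLionsTruncationWeakLimits
import Mathlib.MeasureTheory.Function.Egorov
import Mathlib.MeasureTheory.Function.ConvergenceInMeasure
import HarnessLib

/-!
# Comparison of a weak `L¹` limit with an almost-everywhere limit (Egorov)

Topic: MathematicalPhysics / KineticTheory. A generic measure-theoretic tool for the subsolution
half of the named fact (L12) `diPernaLions_limit_expDuhamel` (Cercignani–Illner–Pulvirenti 1994
§5.3 Lemma 5.3.12, display before (3.44), p. 159: the weak limit `Q₊,ₘ` of the renormalised gain
terms is dominated by the gain term of the limit, "by Lemma 5.3.11 iii)"). In the tree's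
rendering of that step the renormalised gain terms converge only *weakly* in `L¹`, while their
majorants — velocity averages of the quadratic expressions furnished by the collision change of
variables — converge *almost everywhere* (along a subsequence, by the velocity-averaging lemma);
the inequality survives in the limit by Egorov's theorem:

* `TendstoWeaklyL1.ae_le_of_le_of_tendsto_ae` (**proved**): on a `σ`-finite measure space, if
  `uₙ ≤ wₙ` a.e., `uₙ ⇀ u` weakly in `L¹` (integrable sequence and limit) and `wₙ → w` a.e., then
  `u ≤ w` a.e. (On `{w + ε ≤ u, |u| ≤ N, |w| ≤ N}` intersected with a finite-measure piece,
  Egorov's theorem makes `wₙ ≤ w + ε/2` uniformly off a small set for `n` large, so that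
  `∫ uₙ ≤ ∫ u - ε/2 · measure` there, contradicting `∫ uₙ → ∫ u` unless the measure vanishes.)
* `TendstoInMeasure.add_real`, `tendstoInMeasure_zero_of_forall_eventually_le` (**proved**): two small
  helpers on convergence in measure of real functions used downstream.

Everything in this file is proved; no named fact is introduced.

## References

* C. Cercignani, R. Illner, M. Pulvirenti, *The Mathematical Theory of Dilute Gases*, Springer
  (1994), §5.3 Lemma 5.3.11 iii) (p. 156) and proof of Lemma 5.3.12 (p. 159).
* V. I. Bogachev, *Measure Theory* I, Springer (2007), Thm 2.2.1 (Egorov).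
-/

open MeasureTheory Metric Real Set Filter Topology
open scoped ENNReal NNReal

noncomputable section

namespace Literature.MathematicalPhysics.KineticTheory

open Literature.Analysis.FunctionSpaces

section Generic

variable {α : Type*} [MeasurableSpace α] {μ : Measure α}

/-! ## Convergence in measure: two helpers -/

/-- Convergence in measure of real functions is stable under addition. [folklore] -/
theorem _root_.MeasureTheory.TendstoInMeasure.add_real {X Y : ℕ → α → ℝ} {X₀ Y₀ : α → ℝ}
    (hX : TendstoInMeasure μ X atTop X₀) (hY : TendstoInMeasure μ Y atTop Y₀) :
    TendstoInMeasure μ (fun n x => X n x + Y n x) atTop (fun x => X₀ x + Y₀ x) := by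
  rw [tendstoInMeasure_iff_norm] at hX hY ⊢
  intro ε hε
  have hε2 : 0 < ε / 2 := by positivity
  have hsub : ∀ n, {x | ε ≤ ‖X n x + Y n x - (X₀ x + Y₀ x)‖} ⊆
      {x | ε / 2 ≤ ‖X n x - X₀ x‖} ∪ {x | ε / 2 ≤ ‖Y n x - Y₀ x‖} := by
    intro n x hx
    simp only [mem_setOf_eq, mem_union] at hx ⊢
    by_contra h
    push Not at h
    have h3 : ‖X n x + Y n x - (X₀ x + Y₀ x)‖ ≤ ‖X n x - X₀ x‖ + ‖Y n x - Y₀ x‖ := by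
      rw [show X n x + Y n x - (X₀ x + Y₀ x) = (X n x - X₀ x) + (Y n x - Y₀ x) by ring]
      exact norm_add_le _ _
    linarith [h.1, h.2]
  have hlim := (hX (ε / 2) hε2).add (hY (ε / 2) hε2)
  rw [add_zero] at hlim
  refine tendsto_of_tendsto_of_tendsto_of_le_of_le tendsto_const_nhds hlim (fun n => zero_le)
    fun n => (measure_mono (hsub n)).trans (measure_union_le _ _)

/-- A criterion for convergence in measure to `0` of real functions: for every level `η > 0` and
every `ε > 0`, the measures of the sets `{η ≤ |Xₙ|}` are eventually at most `ε`. [folklore] -/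
theorem tendstoInMeasure_zero_of_forall_eventually_le {X : ℕ → α → ℝ}
    (h : ∀ η : ℝ, 0 < η → ∀ ε : ℝ≥0∞, 0 < ε → ∀ᶠ n in atTop, μ {x | η ≤ |X n x|} ≤ ε) :
    TendstoInMeasure μ X atTop (fun _ => 0) := by
  rw [tendstoInMeasure_iff_norm]
  intro η hη
  simp only [sub_zero, Real.norm_eq_abs]
  rw [ENNReal.tendsto_nhds_zero]
  intro ε hε
  exact h η hη ε hε

/-! ## Weak limits versus almost-everywhere limits -/

/-- Auxiliary form of `TendstoWeaklyL1.ae_le_of_le_of_tendsto_ae` with (strongly) measurable data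
on a finite measure space: the bad set `{w + ε ≤ u} ∩ {|u| ≤ N} ∩ {|w| ≤ N}` is null. [folklore] -/
theorem measure_weakLimit_gt_aeLimit_aux [IsFiniteMeasure μ] {u : ℕ → α → ℝ} {ul : α → ℝ}
    {w : ℕ → α → ℝ} {wl : α → ℝ} (hu : TendstoWeaklyL1 u ul μ) (hui : ∀ n, Integrable (u n) μ)
    (huli : Integrable ul μ) (hulm : StronglyMeasurable ul) (hwm : ∀ n, StronglyMeasurable (w n))
    (hwlm : StronglyMeasurable wl) (hle : ∀ n, u n ≤ᵐ[μ] w n)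
    (hlim : ∀ᵐ x ∂μ, Tendsto (fun n => w n x) atTop (𝓝 (wl x))) {ε : ℝ} (hε : 0 < ε) (N : ℝ) :
    μ ({x | wl x + ε ≤ ul x} ∩ {x | |ul x| ≤ N} ∩ {x | |wl x| ≤ N}) = 0 := by
  set A : Set α := {x | wl x + ε ≤ ul x} ∩ {x | |ul x| ≤ N} ∩ {x | |wl x| ≤ N} with hA
  have hAm : MeasurableSet A := by
    refine ((measurableSet_le (hwlm.measurable.add_const _) hulm.measurable).inter
      (measurableSet_le hulm.measurable.abs measurable_const)).inter
      (measurableSet_le hwlm.measurable.abs measurable_const)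
  -- it suffices to bound `μ A` by every `η > 0`
  refine le_antisymm (ENNReal.le_of_forall_pos_le_add fun η hη _ => ?_) zero_le
  rw [zero_add]
  -- Egorov on `A`
  obtain ⟨t, htA, htm, hμt, hunif⟩ := tendstoUniformlyOn_of_ae_tendsto hwm hwlm hAm
    (measure_ne_top μ A) (hlim.mono fun x hx _ => hx) (ε := (η : ℝ)) (by exact_mod_cast hη)
  -- uniform convergence on `A \ t`: eventually `wₙ < wl + ε/2` there
  have hε2 : 0 < ε / 2 := by linarith
  have hev : ∀ᶠ n in atTop, ∀ x ∈ A \ t, dist (wl x) (w n x) < ε / 2 :=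
    Metric.tendstoUniformlyOn_iff.1 hunif (ε / 2) hε2
  -- the set `A \ t` is null
  have hAt : MeasurableSet (A \ t) := hAm.diff htm
  have hnull : μ (A \ t) = 0 := by
    -- `∫_{A \ t} uₙ ≤ ∫_{A \ t} ul - ε/2 μ(A \ t)` eventually, and `∫_{A \ t} uₙ → ∫_{A \ t} ul`
    have hconv := hu.tendsto_setIntegral hAt
    have hbound : ∀ᶠ n in atTop, ∫ x in A \ t, u n x ∂μ ≤
        ∫ x in A \ t, ul x ∂μ - ε / 2 * (μ (A \ t)).toReal := by
      filter_upwards [hev] with n hn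
      have hle' : ∀ᵐ x ∂(μ.restrict (A \ t)), u n x ≤ ul x - ε / 2 := by
        rw [ae_restrict_iff' hAt]
        filter_upwards [hle n] with x hx hxA
        have h1 := hn x hxA
        rw [Real.dist_eq, abs_lt] at h1
        have h2 : wl x + ε ≤ ul x := hxA.1.1.1
        linarith [h1.1, h1.2]
      calc ∫ x in A \ t, u n x ∂μ ≤ ∫ x in A \ t, (ul x - ε / 2) ∂μ :=
            integral_mono_ae (hui n).integrableOn
              (huli.integrableOn.sub (integrableOn_const (measure_ne_top _ _).lt_top.ne)) hle'
        _ = ∫ x in A \ t, ul x ∂μ - ε / 2 * (μ (A \ t)).toReal := by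
            rw [integral_sub huli.integrableOn (integrableOn_const (measure_ne_top _ _).lt_top.ne),
              setIntegral_const, smul_eq_mul, Measure.real, mul_comm]
    have hlimle : ∫ x in A \ t, ul x ∂μ ≤ ∫ x in A \ t, ul x ∂μ - ε / 2 * (μ (A \ t)).toReal :=
      le_of_tendsto_of_tendsto hconv tendsto_const_nhds hbound
    have htr : (μ (A \ t)).toReal ≤ 0 := by nlinarith
    have htr0 : (μ (A \ t)).toReal = 0 := le_antisymm htr ENNReal.toReal_nonneg
    exact (ENNReal.toReal_eq_zero_iff _).1 htr0 |>.resolve_right (measure_ne_top _ _)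
  calc μ A ≤ μ (A \ t) + μ t := by
        calc μ A ≤ μ (A \ t ∪ t) := measure_mono (by intro x hx; by_cases h : x ∈ t <;> simp [h, hx])
          _ ≤ μ (A \ t) + μ t := measure_union_le _ _
    _ ≤ 0 + ENNReal.ofReal η := add_le_add hnull.le hμt
    _ = (η : ℝ≥0∞) := by rw [zero_add, ENNReal.ofReal_coe_nnreal]

/-- **A weak `L¹` limit is dominated by the almost-everywhere limit of its majorants** (the
mechanism by which CIP 1994 pass the inequality `Q₊ⁿ/(1 + fⁿ/m) ≤ …` to the limit on p. 159,
made explicit): on a `σ`-finite measure space let `uₙ ≤ wₙ` a.e., `uₙ ⇀ u` weakly in `L¹(μ)`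
(`TendstoWeaklyL1`, with `uₙ`, `u` integrable) and `wₙ → w` almost everywhere (`wₙ`, `w`
a.e.-strongly measurable). Then `u ≤ w` almost everywhere. [cite: CIPDiluteGases1994, §5.3 proof of Lemma 5.3.12 (p. 159)] -/
theorem _root_.Literature.Analysis.FunctionSpaces.TendstoWeaklyL1.ae_le_of_le_of_tendsto_ae
    [SigmaFinite μ] {u : ℕ → α → ℝ} {ul : α → ℝ} {w : ℕ → α → ℝ} {wl : α → ℝ}
    (hu : TendstoWeaklyL1 u ul μ) (hui : ∀ n, Integrable (u n) μ) (huli : Integrable ul μ)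
    (hwm : ∀ n, AEStronglyMeasurable (w n) μ) (hwlm : AEStronglyMeasurable wl μ)
    (hle : ∀ n, u n ≤ᵐ[μ] w n) (hlim : ∀ᵐ x ∂μ, Tendsto (fun n => w n x) atTop (𝓝 (wl x))) :
    ul ≤ᵐ[μ] wl := by
  -- strongly measurable representatives
  set ul' : α → ℝ := huli.1.mk ul with hul'
  set w' : ℕ → α → ℝ := fun n => (hwm n).mk (w n) with hw'
  set wl' : α → ℝ := hwlm.mk wl with hwl'
  have hulae : ul =ᵐ[μ] ul' := huli.1.ae_eq_mk
  have hwae : ∀ n, w n =ᵐ[μ] w' n := fun n => (hwm n).ae_eq_mk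
  have hwlae : wl =ᵐ[μ] wl' := hwlm.ae_eq_mk
  have hu' : TendstoWeaklyL1 u ul' μ := hu.congr_limit hulae
  have huli' : Integrable ul' μ := huli.congr hulae
  have hle' : ∀ n, u n ≤ᵐ[μ] w' n := fun n =>
    (hle n).mp ((hwae n).mono fun x hx h => hx ▸ h)
  have hlim' : ∀ᵐ x ∂μ, Tendsto (fun n => w' n x) atTop (𝓝 (wl' x)) := by
    have hall : ∀ᵐ x ∂μ, ∀ n, w n x = w' n x := ae_all_iff.2 fun n => hwae n
    filter_upwards [hlim, hall, hwlae] with x hx hx' hxl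
    rw [← hxl]
    exact hx.congr fun n => hx' n
  -- reduce to the representatives
  suffices h : ul' ≤ᵐ[μ] wl' by
    filter_upwards [h, hulae, hwlae] with x hx h1 h2
    rwa [h1, h2]
  -- the bad set, cut into countably many null pieces
  have hpiece : ∀ (k : ℕ) (j : ℕ) (N : ℕ),
      μ (({x | wl' x + ((j : ℝ) + 1)⁻¹ ≤ ul' x} ∩ {x | |ul' x| ≤ N} ∩ {x | |wl' x| ≤ N}) ∩
        spanningSets μ k) = 0 := by
    intro k j N
    set S := spanningSets μ k with hS
    have hSm : MeasurableSet S := measurableSet_spanningSets μ k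
    haveI : IsFiniteMeasure (μ.restrict S) :=
      ⟨by rw [Measure.restrict_apply_univ]; exact measure_spanningSets_lt_top μ k⟩
    have h0 := measure_weakLimit_gt_aeLimit_aux (μ := μ.restrict S) (hu'.restrict hSm)
      (fun n => (hui n).restrict) huli'.restrict huli.1.stronglyMeasurable_mk
      (fun n => (hwm n).stronglyMeasurable_mk) hwlm.stronglyMeasurable_mk
      (fun n => ae_restrict_of_ae (hle' n)) (ae_restrict_of_ae hlim')
      (ε := ((j : ℝ) + 1)⁻¹) (by positivity) (N : ℝ)
    have hm : MeasurableSet ({x | wl' x + ((j : ℝ) + 1)⁻¹ ≤ ul' x} ∩ {x | |ul' x| ≤ N} ∩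
        {x | |wl' x| ≤ N}) :=
      ((measurableSet_le (hwlm.stronglyMeasurable_mk.measurable.add_const _)
        huli.1.stronglyMeasurable_mk.measurable).inter
        (measurableSet_le huli.1.stronglyMeasurable_mk.measurable.abs measurable_const)).inter
        (measurableSet_le hwlm.stronglyMeasurable_mk.measurable.abs measurable_const)
    rwa [Measure.restrict_apply hm] at h0
  have hall : ∀ᵐ x ∂μ, ∀ k j N : ℕ, x ∉ ({x | wl' x + ((j : ℝ) + 1)⁻¹ ≤ ul' x} ∩
      {x | |ul' x| ≤ N} ∩ {x | |wl' x| ≤ N}) ∩ spanningSets μ k := by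
    rw [ae_all_iff]; intro k
    rw [ae_all_iff]; intro j
    rw [ae_all_iff]; intro N
    exact measure_eq_zero_iff_ae_notMem.1 (hpiece k j N)
  filter_upwards [hall] with x hx
  by_contra hcon
  push Not at hcon
  -- choose the parameters
  obtain ⟨j, hj⟩ := exists_nat_one_div_lt (sub_pos.2 hcon)
  obtain ⟨N, hN⟩ := exists_nat_ge (max |ul' x| |wl' x|)
  have hk : x ∈ spanningSets μ (spanningSetsIndex μ x) := mem_spanningSetsIndex μ x
  refine hx (spanningSetsIndex μ x) j N ⟨⟨⟨?_, ?_⟩, ?_⟩, hk⟩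
  · show wl' x + ((j : ℝ) + 1)⁻¹ ≤ ul' x
    rw [one_div] at hj
    linarith
  · show |ul' x| ≤ N
    exact (le_max_left _ _).trans hN
  · show |wl' x| ≤ N
    exact (le_max_right _ _).trans hN

end Generic

end Literature.MathematicalPhysics.KineticTheory
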